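import Mathlib
import Summits.Ventures.PercRepro2.TypedBHKIndepCluster

/-!
# Typed BHK 1.4 single-vertex on the INDEPENDENT CLASS — IV: the theorem
(p5 g3, 2026-08-25; P5-SHAPE.md §9–§10; file 4 of 4)

`tb14_of_indepClass`: on a finite multigraph whose unmarked vertices are adjacent only to the
four marks `{a₁, a₂, b, o}` by single edges, at the all-free profile,
`pairCount F z sameBO ≤ pairCount F z crossBO` — typed BHK 1.4 single-vertex (row 2′TB) on the
INDEPENDENT CLASS. Proof: the folded summand is the source indicator minus the target indicator;
the involution `Φ` (TypedBHKIndepFlip) sends sources to targets (the four cluster lemmas of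
TypedBHKIndepSrc / TypedBHKIndepCluster); re-index by `Fintype.sum_equiv`. No certificate, no
hyperobjects, standard axioms.
-/

namespace Summit.Ventures.PercRepro2

namespace TypedBHKIndep

open CovForm A3InactiveTyped TB14Fold

section Main

variable {V : Type} {E : Type} [Fintype E] [DecidableEq E] [DecidableEq V]
variable {R : Type*} [Field R] [LinearOrder R] [IsStrictOrderedRing R]
variable (ends : E → Sym2 V) (a₁ a₂ b o : V) (F : Finset E) (z : Config E)

open Classical in
/-- The source indicator `1_Q(y)·1_Q(w)·1_{b∈C₁}(y)·1_{o∈C₂}(y)·(1 − 1_{o∈C₂}(w))`. -/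
noncomputable def srcInd : Config E → Config E → R :=
  fun y _ => if IsSource ends a₁ a₂ b o F y then 1 else 0

open Classical in
/-- The target indicator `1_Q(y)·1_Q(w)·1_{b∈C₁}(y)·1_{o∈C₂}(w)·(1 − 1_{o∈C₂}(y))`. -/
noncomputable def tgtInd : Config E → Config E → R :=
  fun y w => if (¬ Conn ends y a₁ a₂ ∧ ¬ Conn ends w a₁ a₂ ∧ Conn ends y a₁ b ∧
      Conn ends w a₂ o ∧ ¬ Conn ends y a₂ o) then 1 else 0

omit [Fintype E] [DecidableEq E] [DecidableEq V] [LinearOrder R] [IsStrictOrderedRing R] in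
open Classical in
/-- `1_{b ∈ C₁}` through the cluster of `a₁`. -/
lemma iL_eq_ite'' (y : Config E) :
    (iL ends a₁ b y : R) = if b ∈ cluster ends y a₁ then 1 else 0 := by
  by_cases h : b ∈ cluster ends y a₁
  · rw [if_pos h]
    simp [iL, Set.indicator_of_mem (show y ∈ connEvent ends a₁ b from h)]
  · rw [if_neg h]
    simp [iL, Set.indicator_of_notMem (show y ∉ connEvent ends a₁ b from h)]

omit [Fintype E] [DecidableEq V] [LinearOrder R] [IsStrictOrderedRing R] in
open Classical in
/-- The folded summand is the source indicator minus the target indicator, pointwise on the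
admissible pairs `(y, flipOn F y)`. -/
lemma foldBO_eq_src_sub_tgt (y : Config E) :
    (foldBO ends a₁ a₂ b o y (flipOn F y) : R) =
      srcInd ends a₁ a₂ b o F y (flipOn F y) - tgtInd ends a₁ a₂ b o y (flipOn F y) := by
  simp only [foldBO, srcInd, tgtInd, iQ_eq_ite, iH_eq_ite, iL_eq_ite'' ends a₁ b]
  have hS : IsSource ends a₁ a₂ b o F y ↔
      (a₁ ∉ cluster ends y a₂ ∧ a₁ ∉ cluster ends (flipOn F y) a₂ ∧ b ∈ cluster ends y a₁ ∧
        o ∈ cluster ends y a₂ ∧ o ∉ cluster ends (flipOn F y) a₂) := by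
    constructor
    · rintro ⟨q₁, q₂, hb, ho, ho'⟩
      exact ⟨fun h => q₁ (conn_symm h), fun h => q₂ (conn_symm h), hb, ho, ho'⟩
    · rintro ⟨q₁, q₂, hb, ho, ho'⟩
      exact ⟨fun h => q₁ (conn_symm h), fun h => q₂ (conn_symm h), hb, ho, ho'⟩
  have hT : (¬ Conn ends y a₁ a₂ ∧ ¬ Conn ends (flipOn F y) a₁ a₂ ∧ Conn ends y a₁ b ∧
      Conn ends (flipOn F y) a₂ o ∧ ¬ Conn ends y a₂ o) ↔
      (a₁ ∉ cluster ends y a₂ ∧ a₁ ∉ cluster ends (flipOn F y) a₂ ∧ b ∈ cluster ends y a₁ ∧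
        o ∈ cluster ends (flipOn F y) a₂ ∧ o ∉ cluster ends y a₂) := by
    simp only [mem_cluster]
    constructor
    · rintro ⟨q₁, q₂, hb, ho, ho'⟩; exact ⟨fun h => q₁ (conn_symm h), fun h => q₂ (conn_symm h), hb, ho, ho'⟩
    · rintro ⟨q₁, q₂, hb, ho, ho'⟩; exact ⟨fun h => q₁ (conn_symm h), fun h => q₂ (conn_symm h), hb, ho, ho'⟩
  simp only [hS, hT]
  by_cases h1 : a₁ ∈ cluster ends y a₂ <;> by_cases h2 : a₁ ∈ cluster ends (flipOn F y) a₂ <;>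
    by_cases h3 : b ∈ cluster ends y a₁ <;> by_cases h4 : o ∈ cluster ends y a₂ <;>
    by_cases h5 : o ∈ cluster ends (flipOn F y) a₂ <;> simp [h1, h2, h3, h4, h5]

omit [LinearOrder R] [IsStrictOrderedRing R] in
/-- **The injection**: a source is sent by `Φ` to a target. -/
lemma tgtInd_Φ_of_source (hF : ∀ e, e ∈ F) (hcls : IndepClass ends a₁ a₂ b o) {y : Config E}
    (hs : IsSource ends a₁ a₂ b o F y) :
    tgtInd ends a₁ a₂ b o (Φ ends a₁ a₂ b o F y) (flipOn F (Φ ends a₁ a₂ b o F y)) = (1 : R) := by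
  unfold tgtInd
  rw [if_pos]
  exact ⟨(not_conn_Φ_a2_o ends a₁ a₂ b o F hF hcls hs).2,
    not_conn_flipOn_Φ_a1_a2 ends a₁ a₂ b o F hF hcls hs,
    conn_Φ_a1_b ends a₁ a₂ b o F hF hcls hs,
    conn_flipOn_Φ_a2_o ends a₁ a₂ b o F hF hcls hs,
    (not_conn_Φ_a2_o ends a₁ a₂ b o F hF hcls hs).1⟩

/-- Termwise: `srcInd y ≤ tgtInd (Φ y)`. -/
lemma srcInd_le_tgtInd_Φ (hF : ∀ e, e ∈ F) (hcls : IndepClass ends a₁ a₂ b o) (y : Config E) :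
    srcInd ends a₁ a₂ b o F y (flipOn F y) ≤
      (tgtInd ends a₁ a₂ b o (Φ ends a₁ a₂ b o F y) (flipOn F (Φ ends a₁ a₂ b o F y)) : R) := by
  unfold srcInd
  split_ifs with hs
  · rw [tgtInd_Φ_of_source ends a₁ a₂ b o F hF hcls hs]
  · unfold tgtInd; split_ifs <;> norm_num

/-- **Theorem C′ (the independent class, all-free profile)**: the folded count is `≤ 0`, i.e.
`N(QAB, Q) ≤ N(QB, QA)`. -/
theorem tb14_of_indepClass (hF : ∀ e, e ∈ F) (hcls : IndepClass ends a₁ a₂ b o) :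
    pairCount F z (sameBO ends a₁ a₂ b o : Config E → Config E → R) ≤
      pairCount F z (crossBO ends a₁ a₂ b o) := by
  rw [← sub_nonpos, pairCount_fold]
  -- pairCount foldBO = pairCount srcInd − pairCount tgtInd; re-index the target sum by Φ
  have hsplit : pairCount F z (foldBO ends a₁ a₂ b o : Config E → Config E → R) =
      pairCount F z (srcInd ends a₁ a₂ b o F) - pairCount F z (tgtInd ends a₁ a₂ b o) := by
    rw [← pairCount_sub]
    unfold pairCount
    refine Finset.sum_congr rfl fun y _ => ?_
    split_ifs
    · exact foldBO_eq_src_sub_tgt ends a₁ a₂ b o F y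
    · rfl
  rw [hsplit, sub_nonpos]
  -- Σ_y srcInd y ≤ Σ_y tgtInd (Φ y) = Σ_y tgtInd y  (Φ a bijection of the admissible y)
  unfold pairCount
  calc (∑ y : Config E, if (∀ e, e ∉ F → y e = z e) then (srcInd ends a₁ a₂ b o F y (flipOn F y) : R) else 0)
      ≤ ∑ y : Config E, if (∀ e, e ∉ F → y e = z e) then
          (tgtInd ends a₁ a₂ b o (Φ ends a₁ a₂ b o F y) (flipOn F (Φ ends a₁ a₂ b o F y)) : R) else 0 := by
        apply Finset.sum_le_sum; intro y _
        split_ifs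
        · exact srcInd_le_tgtInd_Φ ends a₁ a₂ b o F hF hcls y
        · exact le_rfl
    _ = ∑ y : Config E, if (∀ e, e ∉ F → Φ ends a₁ a₂ b o F y e = z e) then
          (tgtInd ends a₁ a₂ b o (Φ ends a₁ a₂ b o F y) (flipOn F (Φ ends a₁ a₂ b o F y)) : R) else 0 := by
        refine Finset.sum_congr rfl fun y _ => ?_
        by_cases hadm : ∀ e, e ∉ F → y e = z e
        · rw [if_pos hadm, if_pos ((Φ_admissible_iff ends a₁ a₂ b o F z y).2 hadm)]
        · rw [if_neg hadm, if_neg (fun h => hadm ((Φ_admissible_iff ends a₁ a₂ b o F z y).1 h))]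
    _ = ∑ y : Config E, if (∀ e, e ∉ F → y e = z e) then (tgtInd ends a₁ a₂ b o y (flipOn F y) : R) else 0 := by
        have hinv : Function.Involutive (Φ ends a₁ a₂ b o F) := fun y => Φ_Φ ends a₁ a₂ b o F hF hcls y
        exact Fintype.sum_equiv hinv.toPerm _ _ (fun y => rfl)

end Main

end TypedBHKIndep

end Summit.Ventures.PercRepro2
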